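import Mathlib
import Summits.NavierStokesRegularity.NavierStokesRegularity.Theorems.AxisTwistDoorAveragedConeLiouvilleNUChain
import Summits.NavierStokesRegularity.NavierStokesRegularity.Theorems.AxisTwistDoorAveragedConeLiouvilleNUWeakDefs
import Literature.Analysis.FluidPDE.DivFreeDriftPositivityPropagation
import HarnessLib

/-!
# Route `AxisTwistDoor`, crux `AveragedConeLiouville` (stmt-NavierStokesRegularity-26889, CLOSED `proved` by p639289) — INPUT N4,
# tier T1 (the typed Literature fact itself): piece CHAINᴸ = the Nazarov–Ural'tseva chain for the WEAK / LIPSCHITZ data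

T1 cut of record (pub/ns-inputs STATUS 2026-08-28T14:03:45Z; kit `kits/N4-T1-skeleton.lean` 118454bf17607d1e l.240; tree texts
`…NULipDefs` p638908 and `…NUWeakDefs` p639785).  This file proves the kit's
`stub_nu_fact_of_atoms : Sig.nuLip_smallSublevel_lowerBound → Sig.nuLip_densityPropagation → Sig.nuLip_shrinking →
Sig.nu_standing_of_weak → NazarovUraltseva2011_positivity_propagation (EuclideanSpace ℝ (Fin 3))` BY NAME over the tree texts
(in-file `example` = the kit line verbatim), as `nu_fact_of_atoms`; the closer `nazarovUraltseva2011_positivity_propagation_R3` is the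
kit owner's file.  It is the re-cut of `nu_factC_of_atoms` (`…NUFactCOfAtoms`, p633388, classical closed-cylinder data) for the data of
the typed fact: measurable bounded drift, distributionally divergence free, `V` Lipschitz on the open cylinder, weak supersolution
inequality — all of which are consumed ONLY by the frames text `Sig.nu_standing_of_weak`; the chain itself uses the identification
`Φ = V(· + τ)` on each frame, the `NUStandingLip` continuity clause below `t = 0`, and the continuity of `V` on the OPEN cylinder
`]0,T[ × B₁` (so every frame top and every closed time interval of the chain is kept `< T`; the fact concludes on `]T/2, T[` anyway).

(n1) PARAMETER SCHEDULE (as in `…NUFactCOfAtoms`) — every constant is a function of `(A, δ, T, r)` and of the atoms' constant-functions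
only, fixed BEFORE the data `b, V` (the fact's quantifier order `∃ β` right after `A δ T r`):  `v = |B₁|`; `r₁ = max(r, ½)`;
`R₀ = max(1 − δ/(6v), (1+r₁)/2)` (so `|B₁ ∖ B(R₀)| ≤ 3v(1−R₀) ≤ δ/2`); frame scale `R_f = (1+R₀)/4` (`R₀ < 2R_f < 1`); room ratio
`λ₃ = 2R_f/R₀ ∈ [1,2]`; `N = N(A)` (text Wᴸ); `δ₀ = min(1, δ/(2v))`; `θ₀ᵃ = θ₀(δ₀,N)`, `θ₀ᵇ = θ₀(1,N)` (L3.2′ᴸ); first window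
`θ₁ = min(θ₀ᵃ, T/3, R_f²/2)`, `h₁ = θ₁R₀²`; chain window `h = min(h₁/2, θ₀ᵇ/4)`; step count `M = ⌈T/h⌉ + 1`; radius decrement
`d = (R₀ − r₁)/(M+1)`, radii `ρ_j = R₀ − j d` (`ρ_{M+1} = r₁`); ratio floor `λlo = min(1+d, λ₃)`; `μ₁ᵃ = μ₁(λlo, θ₁, 4θ₁, N)`,
`μ₁ᵇ = μ₁(λlo, h, 16h, N)` (L3.1′ᴸ), `μᵃ = min(μ₁ᵃ,½)`, `μᵇ = min(μ₁ᵇ,½)`; `sᵃ = s(λlo, θ₁, 4θ₁, μᵃ, δ₀/3, N)`,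
`sᵇ = s(λlo, h, 16h, μᵇ, ⅓, N)` (L3.3′ᴸ); `β₁ = 2^{-(sᵃ+1)}δ₀/3`, `β̂ = 2^{-(sᵇ+1)}/3`; **`β = β̂^M β₁`**.

THE PROOF (frame by frame).  Given the data and `t̄ ∈ ]0,T/3[`, `λ > 0` with `|{V(t̄) ≥ λ} ∩ B₁| ≥ δ`: the annulus bound gives density
`δ₀` of `{V(t̄) ≥ λ}` in `B(R₀)`.  STEP 1 (Cor 3.2 (1), `nu_first_step`) in the Wᴸ-frame with top `τ₁ = t̄ + h₁ < T`: `V ≥ β₁λ` on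
`[t̄ + h₁/2, t̄ + h₁] × B(ρ₁)` (a.e. ⇒ everywhere by the `NUStandingLip` continuity below `t = 0`, then the closed time interval by
continuity of `V`).  CHAIN (Lemma 3.4 by induction on `j ≤ M`): «`V ≥ β̂ʲβ₁λ` on `([t̄ + h₁/2, t̄ + h₁ + jh] ∩ {s < T}) × B(ρ_{j+1})`»;
the step at a time `s < T` of the next window uses the Wᴸ-frame with top `τ = s` (bottom slice `s − h` already covered since
`h ≤ h₁/2`) and `nu_chain_step` (Cor 3.2 (2)).  At `j = M`: `]T/2, T[ ⊆ [t̄ + h₁/2, t̄ + h₁ + Mh]` and `B(r) ⊆ B(ρ_{M+1}) = B(r₁)`.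

* **`nu_fact_of_atoms`** — the piece CHAINᴸ (the four T1 texts ⇒ the typed fact on `EuclideanSpace ℝ (Fin 3)`).

WHAT THIS IS NOT: no NS-regularity statement is touched; N4/T1 is an INPUT (Nazarov–Ural'tseva 2011 §3 re-proved in the kernel for the
printed weak data = Lei–Ren–Tian Lemma 2.5); item 26889 is already closed by p639289 and the summit stays OPEN; this file discharges no
stub of T1 other than CHAINᴸ (M1ᴸ, Wᴸ and the closer are other seats' files).  `--supports stmt-NavierStokesRegularity-26889 --as helper`.
[cite: NazarovUraltseva2011HarnackDivFree, §3 Cor 3.2, Lemma 3.4 (arXiv:1011.1888 pp. 9–10)] [cite: LeiRenTian2025, Lemma 2.5 (arXiv p. 7)]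
-/

noncomputable section

-- the summit and its single sub-problem share the name (CONVENTIONS §1)
set_option linter.dupNamespace false

open MeasureTheory Set Function Metric Filter Topology
open scoped NNReal ENNReal InnerProductSpace Laplacian

namespace Summit.NavierStokesRegularity.NavierStokesRegularity.Theorems.AveragedConeLiouville.NUPositivity

open Literature.Analysis Literature.Analysis.FluidPDE
/-! ### The piece CHAINᴸ -/

set_option maxHeartbeats 800000 in
/-- **T1 piece CHAINᴸ: the typed Nazarov–Ural'tseva fact on `ℝ³` from the four Lipschitz atom texts** (`Sig.nuLip_smallSublevel_lowerBound`
= L3.1′ᴸ, `Sig.nuLip_densityPropagation` = L3.2′ᴸ, `Sig.nuLip_shrinking` = L3.3′ᴸ over `NUStandingLip`, and the weak frames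
`Sig.nu_standing_of_weak` = Wᴸ), by the parameter schedule (n1) and the frame-by-frame chain of the module docstring: Cor 3.2 (1)
(`nu_first_step`) once, then Cor 3.2 (2) (`nu_chain_step`) `M` times (Lemma 3.4).  Uses of the data beyond the atoms: only the
identification `Φ = V(· + τ)` on each frame, the `NUStandingLip` continuity clause below `t = 0` (a.e. ⇒ everywhere) and the continuity
of the Lipschitz `V` on the OPEN cylinder `]0,T[ × B₁` (open ⇒ closed time intervals, all tops `< T`).
[cite: NazarovUraltseva2011HarnackDivFree, §3 Cor 3.2, Lemma 3.4 (arXiv:1011.1888 p. 10)] [cite: LeiRenTian2025, Lemma 2.5 (arXiv p. 7)] -/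
theorem nu_fact_of_atoms :
    Sig.nuLip_smallSublevel_lowerBound → Sig.nuLip_densityPropagation → Sig.nuLip_shrinking →
      Sig.nu_standing_of_weak →
      NazarovUraltseva2011_positivity_propagation (EuclideanSpace ℝ (Fin 3)) := by
  intro hL31 hL32 hL33 hW _ A δ T r hA hδ hT hr hr1
  -- ### (n1) the parameter schedule
  -- the unit ball
  have hB1pos : 0 < volume (ball (0 : EuclideanSpace ℝ (Fin 3)) 1) := measure_ball_pos volume 0 one_pos
  have hB1top : volume (ball (0 : EuclideanSpace ℝ (Fin 3)) 1) ≠ ⊤ := measure_ball_lt_top.ne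
  obtain ⟨v, hvdef⟩ : ∃ v : ℝ, v = (volume (ball (0 : EuclideanSpace ℝ (Fin 3)) 1)).toReal := ⟨_, rfl⟩
  have hv0 : 0 < v := by rw [hvdef]; exact ENNReal.toReal_pos hB1pos.ne' hB1top
  have hvE : volume (ball (0 : EuclideanSpace ℝ (Fin 3)) 1) = ENNReal.ofReal v := by rw [hvdef, ENNReal.ofReal_toReal hB1top]
  -- radii
  obtain ⟨r₁, hr₁⟩ : ∃ x : ℝ, x = max r (1 / 2) := ⟨_, rfl⟩
  have hr₁r : r ≤ r₁ := by rw [hr₁]; exact le_max_left _ _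
  have hr₁h : 1 / 2 ≤ r₁ := by rw [hr₁]; exact le_max_right _ _
  have hr₁1 : r₁ < 1 := by rw [hr₁]; exact max_lt hr1 (by norm_num)
  obtain ⟨R₀, hR₀⟩ : ∃ x : ℝ, x = max (1 - δ / (6 * v)) ((1 + r₁) / 2) := ⟨_, rfl⟩
  have hR₀r₁ : r₁ < R₀ := by rw [hR₀]; exact lt_of_lt_of_le (by linarith) (le_max_right _ _)
  have hR₀1 : R₀ < 1 := by
    rw [hR₀]; refine max_lt ?_ (by linarith)
    have : 0 < δ / (6 * v) := by positivity
    linarith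
  have hR₀0 : 0 < R₀ := by linarith
  have hR₀δ : 3 * v * (1 - R₀) ≤ δ / 2 := by
    have h1 : 1 - δ / (6 * v) ≤ R₀ := by rw [hR₀]; exact le_max_left _ _
    have h2 : 1 - R₀ ≤ δ / (6 * v) := by linarith
    have h3 := mul_le_mul_of_nonneg_left h2 (by positivity : (0 : ℝ) ≤ 3 * v)
    have e : 3 * v * (δ / (6 * v)) = δ / 2 := by field_simp; ring
    linarith [h3, e]
  obtain ⟨Rf, hRf⟩ : ∃ x : ℝ, x = (1 + R₀) / 4 := ⟨_, rfl⟩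
  have hRf0 : 0 < Rf := by rw [hRf]; positivity
  have h2Rf : 2 * Rf < 1 := by rw [hRf]; linarith
  have hR₀Rf : R₀ < 2 * Rf := by rw [hRf]; linarith
  have hRf4 : Rf / 4 ≤ 1 / 2 := by rw [hRf]; linarith
  have hRfR₀ : Rf ^ 2 ≤ R₀ := by nlinarith only [hRf, hR₀1, hR₀r₁, hr₁h]
  obtain ⟨lam₃, hlam₃⟩ : ∃ x : ℝ, x = 2 * Rf / R₀ := ⟨_, rfl⟩
  have hl₃1 : 1 ≤ lam₃ := by rw [hlam₃, le_div_iff₀ hR₀0]; linarith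
  have hl₃2 : lam₃ ≤ 2 := by rw [hlam₃, div_le_iff₀ hR₀0]; linarith
  have hroom₀ : lam₃ * R₀ = 2 * Rf := by rw [hlam₃]; field_simp
  -- the drift constant and the atoms' constants
  obtain ⟨N, hW'⟩ := hW A hA
  obtain ⟨δ₀, hδ₀⟩ : ∃ x : ℝ, x = min 1 (δ / (2 * v)) := ⟨_, rfl⟩
  have hδ₀0 : 0 < δ₀ := by rw [hδ₀]; exact lt_min one_pos (by positivity)
  have hδ₀1 : δ₀ ≤ 1 := by rw [hδ₀]; exact min_le_left _ _
  have hδ₀v : δ₀ * v ≤ δ / 2 := by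
    have : δ₀ ≤ δ / (2 * v) := by rw [hδ₀]; exact min_le_right _ _
    rw [le_div_iff₀ (by positivity)] at this
    linarith
  obtain ⟨θ₀a, hθ₀a0, -, hL32a⟩ := hL32 δ₀ N hδ₀0 hδ₀1
  obtain ⟨θ₀b, hθ₀b0, -, hL32b⟩ := hL32 1 N one_pos le_rfl
  obtain ⟨θ₁, hθ₁⟩ : ∃ x : ℝ, x = min θ₀a (min (T / 3) (Rf ^ 2 / 2)) := ⟨_, rfl⟩
  have hθ₁0 : 0 < θ₁ := by rw [hθ₁]; exact lt_min hθ₀a0 (lt_min (by positivity) (by positivity))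
  have hθ₁a : θ₁ ≤ θ₀a := by rw [hθ₁]; exact min_le_left _ _
  have hθ₁T : θ₁ ≤ T / 3 := by rw [hθ₁]; exact (min_le_right _ _).trans (min_le_left _ _)
  have hθ₁R : θ₁ ≤ Rf ^ 2 / 2 := by rw [hθ₁]; exact (min_le_right _ _).trans (min_le_right _ _)
  obtain ⟨h₁, hh₁⟩ : ∃ x : ℝ, x = θ₁ * R₀ ^ 2 := ⟨_, rfl⟩
  have hh₁0 : 0 < h₁ := by rw [hh₁]; positivity
  have hh₁θ : h₁ ≤ θ₁ := by
    rw [hh₁]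
    have : R₀ ^ 2 ≤ 1 := by nlinarith
    nlinarith
  obtain ⟨h, hh⟩ : ∃ x : ℝ, x = min (h₁ / 2) (θ₀b / 4) := ⟨_, rfl⟩
  have hh0 : 0 < h := by rw [hh]; exact lt_min (by positivity) (by positivity)
  have hhh₁ : h ≤ h₁ / 2 := by rw [hh]; exact min_le_left _ _
  have hhθ : h ≤ θ₀b / 4 := by rw [hh]; exact min_le_right _ _
  have hhRf : h < Rf ^ 2 := by
    have : 0 < Rf ^ 2 := by positivity
    linarith only [hhh₁, hh₁θ, hθ₁R, this]
  obtain ⟨M, hM⟩ : ∃ M : ℕ, M = ⌈T / h⌉₊ + 1 := ⟨_, rfl⟩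
  have hMpos : (0 : ℝ) < M := by rw [hM]; positivity
  have hM1 : (1 : ℝ) ≤ M := by rw [hM]; push_cast; linarith only [Nat.cast_nonneg (α := ℝ) ⌈T / h⌉₊]
  have hMh : T ≤ (M : ℝ) * h := by
    have h1 : T / h ≤ (⌈T / h⌉₊ : ℝ) := Nat.le_ceil _
    have h3 : T ≤ (⌈T / h⌉₊ : ℝ) * h := by rwa [div_le_iff₀ hh0] at h1
    have h2 : (M : ℝ) = (⌈T / h⌉₊ : ℝ) + 1 := by rw [hM]; push_cast; ring
    rw [h2, add_mul, one_mul]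
    linarith
  obtain ⟨d, hd⟩ : ∃ x : ℝ, x = (R₀ - r₁) / (M + 1) := ⟨_, rfl⟩
  have hd0 : 0 < d := by rw [hd]; exact div_pos (by linarith) (by positivity)
  have hdle : d ≤ R₀ - r₁ := by rw [hd]; exact div_le_self (by linarith only [hR₀r₁]) (by linarith only [hMpos])
  have hdle2 : 2 * d ≤ R₀ - r₁ := by
    rw [hd, mul_div_assoc', div_le_iff₀ (by positivity)]
    nlinarith only [hM1, hR₀r₁]
  have hd2 : d < 1 / 2 := by linarith only [hdle, hR₀1, hr₁h]
  have hMd : ((M : ℝ) + 1) * d = R₀ - r₁ := by rw [hd]; field_simp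
  obtain ⟨ρ, hρ⟩ : ∃ ρ : ℕ → ℝ, ∀ j, ρ j = R₀ - j * d := ⟨_, fun _ => rfl⟩
  have hρ_succ : ∀ j, ρ (j + 1) = ρ j - d := fun j => by rw [hρ, hρ]; push_cast; ring
  have hρ_le : ∀ j, ρ j ≤ R₀ := fun j => by
    rw [hρ]; exact sub_le_self _ (mul_nonneg (Nat.cast_nonneg j) hd0.le)
  have hρ_ge : ∀ j, j ≤ M + 1 → r₁ ≤ ρ j := fun j hj => by
    rw [hρ]
    have h1 : (j : ℝ) ≤ M + 1 := by exact_mod_cast hj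
    have h2 : (j : ℝ) * d ≤ ((M : ℝ) + 1) * d := mul_le_mul_of_nonneg_right h1 hd0.le
    linarith only [h2, hMd]
  have hρ_last : ρ (M + 1) = r₁ := by rw [hρ]; push_cast; linarith [hMd]
  obtain ⟨lamlo, hlamlo⟩ : ∃ x : ℝ, x = min (1 + d) lam₃ := ⟨_, rfl⟩
  have hl₃1s : 1 < lam₃ := by rw [hlam₃, lt_div_iff₀ hR₀0]; linarith
  have hlamlo1 : 1 < lamlo := by rw [hlamlo]; exact lt_min (by linarith) hl₃1s
  have hlamlod : lamlo ≤ 1 + d := by rw [hlamlo]; exact min_le_left _ _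
  have hlamlo₃ : lamlo ≤ lam₃ := by rw [hlamlo]; exact min_le_right _ _
  have hlamlo2 : lamlo ≤ 2 := hlamlo₃.trans hl₃2
  -- L3.1′ and L3.3′ constants (first step: windows `[θ₁, 4θ₁]`; chain: windows `[h, 16h]`)
  obtain ⟨μ₁a, hμ₁a0, hL31a⟩ := hL31 lamlo θ₁ (4 * θ₁) N hlamlo1 hlamlo2 hθ₁0 (by linarith)
  obtain ⟨μa, hμa⟩ : ∃ x : ℝ, x = min μ₁a (1 / 2) := ⟨_, rfl⟩
  have hμa0 : 0 < μa := by rw [hμa]; exact lt_min hμ₁a0 (by norm_num)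
  have hμa1 : μa < 1 := by rw [hμa]; exact lt_of_le_of_lt (min_le_right _ _) (by norm_num)
  have hμale : μa ≤ μ₁a := by rw [hμa]; exact min_le_left _ _
  obtain ⟨sa, hL33a⟩ := hL33 lamlo θ₁ (4 * θ₁) μa (δ₀ / 3) N hlamlo1 hlamlo2 hθ₁0 (by linarith) hμa0 hμa1 (by positivity)
  obtain ⟨μ₁b, hμ₁b0, hL31b⟩ := hL31 lamlo h (16 * h) N hlamlo1 hlamlo2 hh0 (by linarith)
  obtain ⟨μb, hμb⟩ : ∃ x : ℝ, x = min μ₁b (1 / 2) := ⟨_, rfl⟩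
  have hμb0 : 0 < μb := by rw [hμb]; exact lt_min hμ₁b0 (by norm_num)
  have hμb1 : μb < 1 := by rw [hμb]; exact lt_of_le_of_lt (min_le_right _ _) (by norm_num)
  have hμble : μb ≤ μ₁b := by rw [hμb]; exact min_le_left _ _
  obtain ⟨sb, hL33b⟩ := hL33 lamlo h (16 * h) μb (1 / 3) N hlamlo1 hlamlo2 hh0 (by linarith) hμb0 hμb1 (by norm_num)
  -- the lower-bound constant
  obtain ⟨β₁, hβ₁⟩ : ∃ x : ℝ, x = (2 : ℝ)⁻¹ ^ (sa + 1) * δ₀ / 3 := ⟨_, rfl⟩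
  have hβ₁0 : 0 < β₁ := by rw [hβ₁]; positivity
  have hβ₁1 : β₁ ≤ 1 := by
    rw [hβ₁]
    have h1 : (2 : ℝ)⁻¹ ^ (sa + 1) ≤ 1 := pow_le_one₀ (by norm_num) (by norm_num)
    have h2 : (2 : ℝ)⁻¹ ^ (sa + 1) * δ₀ ≤ 1 * 1 := mul_le_mul h1 hδ₀1 hδ₀0.le zero_le_one
    linarith only [h2]
  obtain ⟨βh, hβh⟩ : ∃ x : ℝ, x = (2 : ℝ)⁻¹ ^ (sb + 1) / 3 := ⟨_, rfl⟩
  have hβh0 : 0 < βh := by rw [hβh]; positivity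
  have hβh1 : βh ≤ 1 := by
    rw [hβh]
    have : (2 : ℝ)⁻¹ ^ (sb + 1) ≤ 1 := pow_le_one₀ (by norm_num) (by norm_num)
    linarith
  refine ⟨βh ^ M * β₁, by positivity, ?_⟩
  -- ### the data
  intro b V lam tbar hbm hbA hdiv hVLip hV0 hsup hlam htbarI hmass t x ht hx
  have htbar : 0 < tbar := htbarI.1
  have htbarT : tbar < T / 3 := htbarI.2
  have hWV := hW' T V b hbm hbA hdiv hVLip hV0 hsup
  -- the Lipschitz `V` is continuous on the OPEN cylinder; continuity of its time lines there
  have hUo : IsOpen (Ioo 0 T ×ˢ ball (0 : EuclideanSpace ℝ (Fin 3)) 1) := isOpen_Ioo.prod isOpen_ball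
  have hVc : ContinuousOn (uncurry V) (Ioo 0 T ×ˢ ball (0 : EuclideanSpace ℝ (Fin 3)) 1) := by
    obtain ⟨L, hL⟩ := hVLip
    exact hL.continuousOn
  have hVline : ∀ (s : ℝ) (y : EuclideanSpace ℝ (Fin 3)), s ∈ Ioo 0 T → y ∈ ball (0 : EuclideanSpace ℝ (Fin 3)) 1 →
      ContinuousAt (fun u => V u y) s := fun s y hs hy =>
    continuousAt_timeLine hUo hVc (Set.mk_mem_prod hs hy)
  -- ### STEP 1 (Cor 3.2 (1)) in the frame with top `τ₁ = t̄ + h₁`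
  have hτ₁T : tbar + h₁ ≤ T := by linarith only [htbarT, hh₁θ, hθ₁T, hT]
  have hτ₁T' : tbar + h₁ < T := by linarith only [htbarT, hh₁θ, hθ₁T, hT]
  obtain ⟨Φ₁, U₁, hSt₁, hΦ₁⟩ := hWV lam (tbar / 2) (tbar + h₁) Rf hlam (by positivity) (by linarith only [htbar, hh₁0]) hτ₁T hRf0 h2Rf
  have hcont₁ : ContinuousOn (uncurry Φ₁) {z : ℝ × EuclideanSpace ℝ (Fin 3) | z.1 < 0} := hSt₁.2.2.2.2.1
  have hρ1 : ρ 1 = R₀ - d := by rw [hρ]; push_cast; ring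
  have hρ1pos : 0 < R₀ - d := by linarith only [hdle, hR₀r₁, hr₁h]
  have hdens₁ : ENNReal.ofReal δ₀ * volume (ball (0 : EuclideanSpace ℝ (Fin 3)) R₀) ≤
      volume {y : EuclideanSpace ℝ (Fin 3) | y ∈ ball (0 : EuclideanSpace ℝ (Fin 3)) R₀ ∧ lam ≤ Φ₁ (-h₁) y} := by
    have hann := annulus_density_le (P := fun y => lam ≤ V tbar y) hvE hv0 hR₀0 hR₀1.le hR₀δ hδ₀0.le hδ₀v hmass
    refine hann.trans (measure_mono ?_)
    rintro y ⟨hy, hyV⟩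
    refine ⟨hy, ?_⟩
    have e := hΦ₁ (-h₁) y (by linarith only [htbar]) (by linarith only [hh₁0]) (ball_subset_ball hR₀Rf.le hy)
    rw [e, show -h₁ + (tbar + h₁) = tbar by ring]
    exact hyV
  have hstep₁ := nu_first_step (hL32a Φ₁ U₁ lam Rf hSt₁) (hL33a Φ₁ U₁ lam Rf hSt₁) (hL31a Φ₁ U₁ lam Rf hSt₁)
    hμale hδ₀0 hδ₀1 (r := R₀) (r' := R₀ - d) (θ := θ₁) (tb := -h₁) (κ := lam) (lam₃ := lam₃)
    (by linarith only [hRf4, hdle, hR₀r₁, hr₁h]) hρ1pos (by linarith only [hd0]) hlamlo₃ hl₃2 hl₃1 hroom₀.le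
    (by rw [le_div_iff₀ hρ1pos]; nlinarith only [hlamlod, hρ1pos, hR₀1, hd0])
    (by rw [div_le_iff₀ hρ1pos]; linarith only [hdle2, hr₁h])
    le_rfl hθ₁0 hθ₁a le_rfl (by nlinarith only [hh₁θ, hθ₁R, hRf0]) (by rw [← hh₁]; linarith only [hh₁0]) hlam le_rfl hdens₁
  rw [← hh₁] at hstep₁
  -- everywhere on the open cylinder, then for `V` on `]t̄ + h₁/2, t̄ + h₁[ × B(ρ₁)`, then on the closed interval
  have hopen₁ := forall_le_of_ae_cylinder_le hcont₁ (by linarith only [hh₁0]) hstep₁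
  have hQ0 : ∀ s ∈ Icc (tbar + h₁ / 2) (tbar + h₁), ∀ y ∈ ball (0 : EuclideanSpace ℝ (Fin 3)) (ρ 1),
      β₁ * lam ≤ V s y := by
    intro s hs y hy
    rw [hρ1] at hy
    have hy1 : y ∈ ball (0 : EuclideanSpace ℝ (Fin 3)) 1 := ball_subset_ball (by linarith only [hd0, hR₀1]) hy
    refine le_on_Icc_of_le_on_Ioo (by linarith only [hh₁0])
      (fun u hu => hVline u y ⟨by linarith only [hu.1, htbar, hh₁0], by linarith only [hu.2, hτ₁T']⟩ hy1)
      (fun u hu => ?_) s hs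
    have e := hΦ₁ (u - (tbar + h₁)) y (by linarith only [hu.1, htbar, hh₁0]) (by linarith only [hu.2])
      (ball_subset_ball (by linarith only [hd0, hR₀Rf]) hy)
    rw [show u - (tbar + h₁) + (tbar + h₁) = u by ring] at e
    rw [← e, hβ₁]
    exact hopen₁ (u - (tbar + h₁)) ⟨by linarith only [hu.1], by linarith only [hu.2]⟩ y hy
  -- ### THE CHAIN (Lemma 3.4), by induction on the number of windows
  have key : ∀ j : ℕ, j ≤ M → ∀ s ∈ Icc (tbar + h₁ / 2) (tbar + h₁ + j * h), s < T →
      ∀ y ∈ ball (0 : EuclideanSpace ℝ (Fin 3)) (ρ (j + 1)), βh ^ j * (β₁ * lam) ≤ V s y := by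
    intro j
    induction j with
    | zero =>
      intro _ s hs _ y hy
      simp only [Nat.cast_zero, zero_mul, add_zero, pow_zero, one_mul] at hs ⊢
      exact hQ0 s hs y hy
    | succ j ih =>
      intro hj s hs hsT y hy
      have ih' := ih (Nat.le_of_succ_le hj)
      have hjM : ((j : ℕ) : ℝ) + 1 ≤ M := by exact_mod_cast hj
      have hs2 : s ≤ tbar + h₁ + ((j : ℝ) + 1) * h := by
        have := hs.2; push_cast at this; exact this
      have hρj1 : r₁ ≤ ρ (j + 1) := hρ_ge _ (by omega)
      have hρj2 : r₁ ≤ ρ (j + 2) := hρ_ge _ (by omega)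
      have hρj2' : ρ (j + 2) = ρ (j + 1) - d := hρ_succ (j + 1)
      have hρj1le : ρ (j + 1) ≤ R₀ := hρ_le _
      have hρj2pos : 0 < ρ (j + 2) := by linarith only [hρj2, hr₁h]
      have hρj1pos : 0 < ρ (j + 1) := by linarith only [hρj1, hr₁h]
      have hjh : 0 ≤ (j : ℝ) * h := by positivity
      have hκ0 : 0 < βh ^ j * (β₁ * lam) := by positivity
      have hβhj1 : βh ^ j ≤ 1 := pow_le_one₀ hβh0.le hβh1
      by_cases hsle : s ≤ tbar + h₁ + j * h
      · -- already covered
        have h0 := ih' s ⟨hs.1, hsle⟩ hsT y (ball_subset_ball (by linarith only [hρj2', hd0]) hy)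
        have : βh ^ (j + 1) * (β₁ * lam) ≤ βh ^ j * (β₁ * lam) := by
          have h1 := mul_le_mul_of_nonneg_left hβh1 hκ0.le
          have h2 : βh ^ (j + 1) * (β₁ * lam) = βh ^ j * (β₁ * lam) * βh := by rw [pow_succ]; ring
          rw [h2]
          linarith only [h1]
        exact this.trans h0
      · push Not at hsle
        -- the bottom slice `s - h` is covered by the induction hypothesis
        have hsh : tbar + h₁ / 2 ≤ s - h := by linarith only [hsle, hhh₁, hjh]
        have hbot : ∀ y' ∈ ball (0 : EuclideanSpace ℝ (Fin 3)) (ρ (j + 1)), βh ^ j * (β₁ * lam) ≤ V (s - h) y' :=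
          ih' (s - h) ⟨hsh, by linarith only [hs2]⟩ (by linarith only [hsT, hh0])
        have hs0 : tbar / 2 < s := by linarith only [hs.1, htbar, hh₁0]
        -- the frame with top `τ = s`
        obtain ⟨Φ, U', hSt, hΦV⟩ := hWV lam (tbar / 2) s Rf hlam (by positivity) hs0 hsT.le hRf0 h2Rf
        have hcont : ContinuousOn (uncurry Φ) {z : ℝ × EuclideanSpace ℝ (Fin 3) | z.1 < 0} := hSt.2.2.2.2.1
        have hθeq : h / ρ (j + 1) ^ 2 * ρ (j + 1) ^ 2 = h := by field_simp
        have hρsq : ρ (j + 1) ^ 2 ≤ 1 := by nlinarith only [hρj1le, hR₀1, hρj1pos]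
        have hρsq' : 1 / 4 ≤ ρ (j + 1) ^ 2 := by nlinarith only [hρj1, hr₁h]
        have hθlo' : h ≤ h / ρ (j + 1) ^ 2 := by
          rw [le_div_iff₀ (by positivity)]; nlinarith only [hρsq, hh0]
        have hθhi' : h / ρ (j + 1) ^ 2 ≤ 4 * h := by
          rw [div_le_iff₀ (by positivity)]; nlinarith only [hρsq', hh0]
        have hρj2pos' : 0 < ρ (j + 1) - d := by rw [← hρj2']; exact hρj2pos
        have hκk : βh ^ j * (β₁ * lam) ≤ lam := by
          have h1 : βh ^ j * (β₁ * lam) ≤ 1 * (β₁ * lam) := mul_le_mul_of_nonneg_right hβhj1 (by positivity)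
          have h2 : β₁ * lam ≤ 1 * lam := mul_le_mul_of_nonneg_right hβ₁1 hlam.le
          linarith only [h1, h2]
        have hstep := nu_chain_step (hL32b Φ U' lam Rf hSt) (hL33b Φ U' lam Rf hSt) (hL31b Φ U' lam Rf hSt)
          hμble (r := ρ (j + 1)) (r' := ρ (j + 2)) (θ := h / ρ (j + 1) ^ 2) (tb := -h) (κ := βh ^ j * (β₁ * lam))
          (lam₃ := lam₃) (by linarith only [hRf4, hρj2, hr₁h]) hρj2pos (by linarith only [hρj2', hd0]) hlamlo₃ hl₃2 hl₃1
          (by nlinarith only [hρj1le, hl₃1, hroom₀])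
          (by rw [hρj2', le_div_iff₀ hρj2pos']; nlinarith only [hlamlod, hρj2pos', hρj1le, hR₀1, hd0])
          (by rw [hρj2', div_le_iff₀ hρj2pos']; linarith only [hd2, hr₁h, hρj2, hρj2'])
          hθlo' (by positivity) (by linarith only [hθhi', hhθ]) (by linarith only [hθhi']) (by linarith only [hhRf])
          (by rw [hθeq]; linarith only [hh0]) hκ0 hκk
          (fun y' hy' => by
            have e := hΦV (-h) y' (by linarith only [hsh, htbar, hh₁0]) (by linarith only [hh0])
              (ball_subset_ball (by linarith only [hρj1le, hR₀Rf]) hy')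
            rw [e, show -h + s = s - h by ring]
            exact hbot y' hy')
        rw [hθeq, show -h + h = (0 : ℝ) by ring] at hstep
        have hopen := forall_le_of_ae_cylinder_le hcont le_rfl hstep
        -- back to `V` on `]s - h, s[ × B(ρ_{j+2})`, then at the top slice `s` by continuity
        have hy1 : y ∈ ball (0 : EuclideanSpace ℝ (Fin 3)) 1 := ball_subset_ball (by linarith only [hρ_le (j + 2), hR₀1]) hy
        have hcl := le_on_Icc_of_le_on_Ioo (a := s - h) (b := s) (c := (2 : ℝ)⁻¹ ^ (sb + 1) / 3 * (βh ^ j * (β₁ * lam)))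
          (x := y) (V := V) (by linarith only [hh0])
          (fun u hu => hVline u y ⟨by linarith only [hu.1, hsh, htbar, hh₁0], by linarith only [hu.2, hsT]⟩ hy1)
          (fun u hu => by
            have e := hΦV (u - s) y (by linarith only [hu.1, hsh, htbar, hh₁0]) (by linarith only [hu.2])
              (ball_subset_ball (by linarith only [hρ_le (j + 2), hR₀Rf]) hy)
            rw [show u - s + s = u by ring] at e
            rw [← e]
            exact hopen (u - s) ⟨by linarith only [hu.1], by linarith only [hu.2]⟩ y hy)
          s ⟨by linarith only [hh0], le_rfl⟩
        calc βh ^ (j + 1) * (β₁ * lam) = (2 : ℝ)⁻¹ ^ (sb + 1) / 3 * (βh ^ j * (β₁ * lam)) := by rw [pow_succ, hβh]; ring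
          _ ≤ V s y := hcl
  -- ### conclusion on `]T/2, T[ × B(r)`
  have hxr : x ∈ ball (0 : EuclideanSpace ℝ (Fin 3)) (ρ (M + 1)) := by
    rw [hρ_last]; exact ball_subset_ball hr₁r hx
  have hfin := key M le_rfl t ⟨by linarith only [ht.1, htbarT, hh₁θ, hθ₁T], by linarith only [ht.2, hMh, htbar, hh₁0]⟩ ht.2 x hxr
  calc βh ^ M * β₁ * lam = βh ^ M * (β₁ * lam) := by ring
    _ ≤ V t x := hfin

/-- Landing check: the kit's `stub_nu_fact_of_atoms` (118454bf17607d1e l.240) BY NAME over the tree texts. -/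
example : Sig.nuLip_smallSublevel_lowerBound → Sig.nuLip_densityPropagation → Sig.nuLip_shrinking →
    Sig.nu_standing_of_weak → NazarovUraltseva2011_positivity_propagation (EuclideanSpace ℝ (Fin 3)) :=
  nu_fact_of_atoms

end Summit.NavierStokesRegularity.NavierStokesRegularity.Theorems.AveragedConeLiouville.NUPositivity

end
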